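import Summits.QuantumFields.YangMills.Theorems.BalabanUVNodesPortHRecordJoinToDoor
import Summits.QuantumFields.YangMills.Theorems.BalabanUVNodesK0V23Stub3CofinalRunDoorAx

/-!
# K0ᴬ (stmt-QuantumFields-27238 `Record13SepCoPHInhabitedAx`) — W-UDR's RESIDUAL ON THE JOIN NODE, TYPED: the JOIN of the two signed port texts lands on the
# COFINAL door `K0PiDecayCofinalRadiiAx`, and of the JOIN's thirteen displayed antecedents TEN are tree theorems on cofinally small radii — the residual is
# {U_k existence ∕ unique orbit, background-field analyticity, the locality token} (+ the two texts + the (1.21)-Ax letter)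

LANDED (declarations and proofs byte-identical to ★ P3 g88's token-free scratch; this one paragraph added) by porter PTC-1 g3 (`ymgap-nodeO-port-PTC-1`, the O-8∕O-11 JOIN pen
whose `JoinAntecedents` ∕ `decayConclR_of_texts` ∕ `JoinConclLimR` ∕ `JoinAntecedentsCofinalRadii` (the last = P3's §1, moved into ✓`…PortHRecordJoinToDoor` §6 ahead of this file so
that no definition sits in the route file's import cone — gate lint `theses-cone`) this file consumes BY NAME, as `Summits/QuantumFields/YangMills/Theorems/BalabanUVNodesK0AxJoinResidual.lean`
`--supports stmt-QuantumFields-27238 --as helper` (INTENT-20, nodeO STATUS 2026-08-31T05:20:55Z), on ★ P3 g88's OFFERS of 05:17:34Z (v1 0979a84191728227) and 05:26:50Z (§6 «the token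
is a cut point + the token-free door» folded in: bytes = P3's `memos/lines/tools-P3g88/scratch-tokfree-v1.lean` 98484bd6e9401a43 · 338 l. · 0 def · 16 thm; farm rc 0 · 0 err · 0 warn ·
0 sorry at P3's desk 05:26:14Z and re-checked by PTC-1).  AUTHORSHIP = ★ P3 g88.
HOME sketch of the ideation cell `ym-nodeO-ideate`, LENS P3 «weaken the target» (seat ★ P3 g88; COUNT-NEUTRAL: nothing is filed by this seat; landing, if wanted, is the
pen holders' (▶ PTC-1 ∕ ★★ dag-n20-d ∕ ★★ dag-lead) as `…/Theorems/BalabanUVNodesK0AxJoinResidual.lean --supports stmt-QuantumFields-27238 --as helper`).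
Generated 2026-08-31T05:15Z by `folder/sk/make_join_residual.py` from `lean/Summits/QuantumFields/YangMills/Theorems/BalabanUVNodesPortHRecordJoinToDoor.lean` (sha16 680a4bd8430dce4b): the two residual TEXTS below (U_k, Bg) are conjuncts 11 and 12 of
▶ PTC-1's `PortHRecordJoin.JoinAntecedents` VERBATIM (sliced mechanically; sha16 of the sliced texts: U_k a9a0ae07a4ea95fa, Bg 89a0a4efeb7c481c), so that `joinAntecedentsCofinalRadii_of_residual`
re-assembles `JoinAntecedents` by `exact ⟨…⟩` with no conversion.

WHAT (0 `sorry`, 1 `def`, 9 `theorem`; standard axioms expected):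
* §1 `JoinAntecedentsCofinalRadii Tok F` — ▶ PTC-1's supply shape `JoinAntecedentsCofinal Tok F` (INTENT-18: «∀ Mth, ∀ a₀ > 0, ∃ Mc ≥ Mth, … JoinAntecedents …», displayed at EVERY
  radius) WEAKENED to COFINALLY SMALL radii: «∀ Mth, ∀ a > 0, ∃ a₀ ∈ ]0, a], ∃ Mc ≥ Mth, ∃ j c c₀ c₁ B₃ B₃' a₁, JoinAntecedents Tok F Mc j c c₀ c₁ B₃ B₃' a₀ a₁»; `…_of_cofinal` (one line).
* §2 ★ `k0PiDecayCofinalRadiiAx_of_texts_cofinalRadii` — ⁸ (`∀ F, Sig8LR4 F`) ∧ a ⁷-shaped text (`∀ F, Sig7With Tok F`, `Tok ⟹ TokP9L4Old`) ∧ the COFINAL-RADII supply ∧ the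
  (1.21)-Ax run letter (levels ≤ ½) ⟹ W-UDR-Ax `K0V23Stub3CofinalRunDoorAx.K0PiDecayCofinalRadiiAx` (INTENT-18's radius-uniform JOIN `decayConclR_of_texts` read at level
  `min γ₀ ½`, exactly as `decayLetter_of_texts` but one radius `a₀ ≤ a` at a time); ★ `record13SepCoPHInhabitedAx_of_texts_cofinalRadii` — K0ᴬ BY NAME through ✓p810573's
  `record13SepCoPHInhabitedAx_of_k0PiDecayCofinalRadiiAx` (stub 1ᴮ PROVED, stub 2′ green, seam `rfl` inside).  INTENT-19's `record13SepCoPHInhabitedAx_of_texts` is the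
  special case `…_of_cofinal` (all radii ⟹ cofinal radii).
* §3 ★★ `joinAntecedentsCofinalRadii_of_residual` — THE CENSUS: for every token `Tok`, the cofinal-radii supply at `F` follows from THREE displayed residual hypotheses, each
  below ITS OWN radius ceiling and above its own cut-off floor `M₀` (admissible letters `Mc = L^e` only; print's «for M large enough, fields small enough») — (R-Uk) [15]
  Thm 1's existence ∕ unique-orbit clause for the record's U_k (conjunct 11),
  (R-Bg) real-analyticity at `B = 0` of the record's background field `recordBgField` (conjunct 12), (R-Tok) the locality token `Tok F Mc a₀` (conjunct 13) — the other TEN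
  conjuncts being DISCHARGED by tree theorems: (1) `McGuard` (`mcGuard_pow`, `Mc := L^e`, `e := max Mth (max M₀ᵁ (max M₀ᴮ M₀ᵀ)) ≤ L^e` by `Nat.lt_pow_self`); (5) `2L² ≤ B₃`, (7) `0 < a₀ ≤ aS(F)`
  and the (8)ᴮ member
  from stub 1ᴮ ✓p809724 `K0Stub1BHolds.prop8StepCoPGridGBAt_holds` (radius shrunk by `of_le` — THIS is where «cofinal radii» is load-bearing: (8)ᴮ is a theorem at `∃ aS(F)`
  and below, not at every radius); (2)–(4) the grid letters `c' ≤ L^j`, `c₀ ≤ j+1`, `c₁ ≤ j`, (6) `0 < B₉`, (8) `0 < a₁'` and (10) Gauge 9 from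
  ✓`K0PrintCubeOfStepTokensGridGuardedB.gauge9SupplierG3B_of_prop6MemberP` fed by the green [6] Prop. 6 ✓`K0V23Stub3CofinalRunDoorAx.twoPrimeAx`; (9) [15] Thm 1 (7)-regularity
  from ✓`N07Thm1Top7FromProp8GuardedB.variationalThm1RegSepCoP7MGB_of_prop8TopStepGB_lamDatum` (grid letter re-based `c ↦ c'` by `of_imp`) — verbatim the discharge lines of
  ✓p810573's `k0BodyAx_of_k0RunCofinalRadiiAx`.
* §4 ★★★ `record13SepCoPHInhabitedAx_of_texts_residual` — FOR EVERY TOKEN `Tok` (with `Tok ⟹ TokP9L4Old`): ⁸ ∧ a ⁷-shaped text `Sig7With Tok` ∧ (R-Uk) ∧ (R-Bg) ∧ (R-Tok) per family ∧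
  the (1.21)-Ax letter ⟹ K0ᴬ BY NAME — W-UDR's residual distance to inhabitation on the JOIN node, DISPLAYED ONE HYPOTHESIS PER BAŁABAN TOKEN, every structural antecedent
  discharged in the kernel.  TOKEN-PARAMETRIC = the consumer-in-waiting for the corrected locality token (T‴, №508 (2)(iii): a Theorems-side `Sig7V12`-shaped helper Prop,
  ★ PTB-1 after V13; ◇ lens-1 NODE v8): any `Tok'` with a ⁷-shaped text `Sig7With Tok'` instantiates it verbatim.
  ☆ `record13SepCoPHInhabitedAx_of_textsG4_residual` (+ `_window`) — the instance AT THE SIGNED v11-G₄ TEXT of stmt-QuantumFields-27931 (`Sig7V11G4`; token `TokP9L4New ∧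
  TokRest4`, `TokRest4 ↔ Tok182 ∧ TokCmpUcap`): residual tokens (R-‴), (R-182), (R-cmpU) displayed separately.  **IMPLICATION-ONLY per ★★★ №508 (04:50:26Z)**: the displayed
  hypothesis `h182` (Tok-182 at the record, eventually in `Mc`, below a radius ceiling) is FALSE-SHAPED AS CUT (▶ PTZ-1 O-Tok182 memo v1 39afd2c5c054e08c: pure-gauge term
  `recordHr = recordHrLocξ univ + dχ·ρ₈` via the tree's `linAvg_eq_bondAvg_sub_grad_combMean` :721; ◆ CRIT-1 concurrence 04:49:39Z; class FALSE-SHAPED · KERNEL-UNDECIDABLE —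
  no `¬Tok182` theorem exists or is claimed) ⇒ the ☆ instances are NOT CONSUMABLE toward K0ᴬ; they are kept as the TYPED LOCATION OF THE BREAK: of the five residual tokens on
  the G₄ road exactly one, (R-182), is false-shaped — the lens's «which edge breaks».
* §5 ★★★ `record13SepCoPHInhabitedAx_of_lim_residual` — the `h121`-FREE edition over ▶ PTC-1's appended §5 `JoinConclLimR Tok F` (the radius-uniform JOIN consequent with the
  (1.21) proviso DISCHARGED IN SCOPE — docket O-11's limit-twin target, ◇ lens-1 SCOPE FLAG): `(∀ F, JoinConclLimR Tok F)` ∧ (R-Uk) ∧ (R-Bg) ∧ (R-Tok) ⟹ K0ᴬ BY NAME — no text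
  hypothesis, no (1.21) letter: O-11's consequent + P0-at-the-record + one locality token is the whole residual (via `k0PiDecayCofinalRadiiAx_of_lim_cofinalRadii` = PTC-1's
  `decayLetter_of_lim` read one radius `a₀ ≤ a` at a time).

LENS P3 READING («weaken the target»; memo `memos/ROUTE-P3.md` v3.115 §1 item 130 (4)).  (i) The weakest uniform statement short of [I] Thm 2 that feeds K0ᴬ through the decay
road is W-UDR-Ax = `K0PiDecayCofinalRadiiAx` (✓p810573 :90); INTENT-18∕19 reach K0ᴬ through the STRONGER all-radii letter T′ because their supply `JoinAntecedentsCofinal` is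
displayed at every radius — but the tree can feed the supply only on cofinally small radii ((8)ᴮ = stub 1ᴮ at `∃ aS(F)`), so the cofinal door is the one the typed DAG
actually uses once the structural antecedents are discharged: §3 is that discharge.  (ii) Edges fed: K0ᴬ `Record13SepCoPHInhabitedAx` BY NAME (→ `closes` binder 1 of
`Theses/BalabanUVNodes.lean` rev 36).  Edges NOT fed: the V24 BOX stub 3ᴬ′ᴮ (`AbsBetaBoxAtThm1WitnessCCMGenGridGZBAxAt`; RUN ⇏ BOX, ✓`K0V23Stub3RunBoxEquivalence.
exists_hbeta_runAbs_not_box`), K1ᴬ∕K2ᴬ∕K3ᴬ (different letters: run rows with continuity ∕ rates ∕ (1.21) window).  Edge that BREAKS: the G₄ road at (R-182) (№508: «the decay road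
through G₄ is DEAD AT DISCHARGE until T‴ lands JOIN-side» — §4's token-parametric ★★★ is where T‴ plugs in).  (iii) What remains on this node after this file, as
hypotheses of §4: ⁸ (27930, OPEN) · a ⁷-shaped text (27931 v11-G₄, OPEN — implication-only road; or its T‴∕road-(2) successor) · (R-Uk) = N07's [15] Thm 1 existence ∕
unique orbit AT THE RECORD for radii below a ceiling and cut-offs above a floor (tree doors:
`N07DirectMethodInduction.ukExists_of_closureMinimisers_mem`, `exists8_allLevels_of_improvement` — interiority ∕ improvement sentences displayed there) · (R-Bg) = port-side
analyticity of the background field in `B` ([15] (2.11) ∕ [16]; named by ◼ port-lead v6.82 O-9 as «the item to NAME»; = ⁸'s TokP9reg per ▶ PTA-1 04:56:18Z (ii)) — (R-Uk) and (R-Bg)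
together are the displayed outputs AT THE RECORD of ◆ CRIT-1's prerequisite **P0 := [15] Thm 1 as a NAMED MAP** (04:54:25Z: contraction `T_t`, «its fixed point is an `IsBackground`
minimiser», `UniqueUkOrbit`; behind the tree's `UkSel` there is only a measurable choice, `exists_measurable_ukSelector` :69) — so this census and CRIT-1's pricing agree on WHAT
remains: P0 at the record + one locality token + the two texts + (1.21) · (R-Tok) = the locality token: at G₄, (R-‴) ∧ (R-182) ∧
(R-cmpU) = [15] Prop. 9 (190), (182), Ucap AT THE RECORD with (R-182) FALSE-SHAPED AS CUT (№508) — to be REPLACED by T‴ (`Sig7V12`-shaped helper, DEF-1 ed.17 names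
`recordCombFlux` ∕ `recordChiLocξ W`) · the (1.21)-Ax letter (K3ᴬ∕(D4) currency; ◇ lens-1's SCOPE FLAG: feedable in scope only by the O-11 limit twin — when that lands, `h121`
is the next conjunct to strike and this file's §2 takes the twin's in-scope (1.21) instead).

HONEST FRAMING (binding).  CONDITIONAL helpers, NOT closers; nothing of Bałaban is asserted, ported, priced or discharged here — the three residual hypotheses, the two
texts and the (1.21)-Ax letter are OPEN signed texts ∕ displayed Bałaban tokens, inhabited nowhere in the tree, and (R-182) is FALSE-SHAPED AS CUT (№508: the ☆ G₄ instances are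
IMPLICATION-ONLY, NOT consumable); typed ≠ proved; K0ᴬ stmt-QuantumFields-27238 OPEN (not
claimed); K1ᴬ 27239 ∕ K2ᴬ 27246 ∕ K3ᴬ 27247 OPEN; 27930 ∕ 27931 OPEN; NODE O 0∕1; COUNT 8∕28 · K 1∕4 UNMOVED; R4 = the CONDITIONAL finite-𝕋⁴ rung `BalabanLadder.UV` at
fixed `ε = L^(−K)` — NOT continuum ∕ ℝ⁴ ∕ OS; **the Yang–Mills mass gap (Clay) is NOT proved by any of this.**  No `sorry` ∕ `instance` ∕ `notation`.
[I] = [Balaban1987RG1]; [15] = [Balaban1985Variational]; [6] = [Balaban1985RegularSpaces]; [16] = [Balaban1985BackgroundPropagators].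
-/

noncomputable section

open scoped BigOperators Matrix.Norms.L2Operator Topology

namespace Summit.QuantumFields.YangMills.Theorems.K0AxJoinResidual

open Summit.QuantumFields.YangMills.Theorems.K0RecordFormatNames
open Summit.QuantumFields.YangMills.Theorems
open Summit.QuantumFields.YangMills.Theorems.PortHRecordJoin
open Summit.QuantumFields.YangMills.Theorems.K0V23Stub3CofinalRunDoorAx (K0PiDecayCofinalRadiiAx twoPrimeAx record13SepCoPHInhabitedAx_of_k0PiDecayCofinalRadiiAx)
open Literature.MathematicalPhysics.QuantumFieldTheory.Balaban1983to89
open Literature.MathematicalPhysics.QuantumFieldTheory.Balaban1983to89.Node00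
open Literature.MathematicalPhysics.QuantumFieldTheory.Balaban1983to89.T4Continuum (T4Family)
open Literature.MathematicalPhysics.QuantumFieldTheory.Balaban1983to89.FlowStep
open Literature.MathematicalPhysics.QuantumFieldTheory.Balaban1983to89.FlowStepRuns
open Literature.MathematicalPhysics.QuantumFieldTheory.Balaban1983to89.T4OutputRate (Window)
open Literature.MathematicalPhysics.QuantumFieldTheory.Balaban1983to89.Node00.U3KernelLetters (PolLimitsExist)
open Summit.QuantumFields.YangMills.BalabanUVNodes.K0Stub1BHolds (prop8StepCoPGridGBAt_holds)
open Summit.QuantumFields.YangMills.BalabanUVNodes.N07Thm1Top7FromProp8GuardedB (variationalThm1RegSepCoP7MGB_of_prop8TopStepGB_lamDatum)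
open Summit.QuantumFields.YangMills.Theorems.K0PrintCubeOfStepTokensGridGuardedB (gauge9SupplierG3B_of_prop6MemberP)

/-! ## §2  ★ The texts + the cofinal-radii supply ⟹ W-UDR-Ax ⟹ K0ᴬ BY NAME -/

/-- ★ **⁸ ∧ ⁷-shaped text ∧ COFINAL-RADII supply ∧ (1.21)-Ax run letter ⟹ W-UDR-Ax** `K0PiDecayCofinalRadiiAx`: ▶ PTC-1's radius-uniform JOIN `decayConclR_of_texts` at the
supplied member, level `min γ₀ ½` (antitonicity in the level is inside the JOIN's consequent `∀ γ ≤ γ₀`).  CONDITIONAL; nothing of [I]∕[15] discharged.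
[cite: Balaban1987RG1, Thm 1 p.259, Thm 3 p.264, (1.21)–(1.22) p.264, (4.35) p.290, (5.10) p.293; Balaban1985Variational, Prop. 9 p.309] -/
theorem k0PiDecayCofinalRadiiAx_of_texts_cofinalRadii (Tok : T4Family → ℕ → ℝ → Prop)
    (hBr : ∀ (F : T4Family) (Mc : ℕ) (a₀ : ℝ), Tok F Mc a₀ → TokP9L4Old F Mc a₀)
    (h8 : ∀ F, Sig8LR4 F) (h7 : ∀ F, Sig7With Tok F) (hA : ∀ F, JoinAntecedentsCofinalRadii Tok F)
    (h121 : ∀ (F : T4Family) (a₀ ε₂₉ γ : ℝ), 0 < a₀ → 0 < ε₂₉ → 0 < γ → γ ≤ 1 / 2 → RecordPolLimitOnRunsAx F a₀ ε₂₉ γ) :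
    K0PiDecayCofinalRadiiAx := by
  intro F a ha
  obtain ⟨Mth, hJ⟩ := decayConclR_of_texts Tok hBr F (h8 F) (h7 F)
  obtain ⟨a₀, ha₀, hle, Mc, hMc, j, c, c₀, c₁, B₃, B₃', a₁, hAnt⟩ := hA F Mth a ha
  obtain ⟨γ₀, ε₂₉, C, δ₁, hγ₀, hε, himp⟩ := hJ Mc hMc j c c₀ c₁ B₃ B₃' a₀ a₁ hAnt
  have hγ : 0 < min γ₀ (1 / 2 : ℝ) := lt_min hγ₀ (by norm_num)
  exact ⟨a₀, ha₀, hle, min γ₀ (1 / 2), ε₂₉, C, δ₁, hγ, min_le_right _ _, hε,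
    himp _ (min_le_left _ _) (h121 F a₀ ε₂₉ _ ha₀ hε hγ (min_le_right _ _))⟩

/-- ★ **K0ᴬ BY NAME from the texts on the COFINAL-RADII supply** (INTENT-19's `record13SepCoPHInhabitedAx_of_texts` is the special case `joinAntecedentsCofinalRadii_of_cofinal`).
CONDITIONAL helper; K0ᴬ OPEN; the mass gap is NOT proved. [cite: Balaban1987RG1, Thm 1 p.259, Thm 3 p.264, (1.22) p.264, (5.10) p.293, (5.42) p.297; Balaban1985Variational, Thm 1 (8)–(9) p.279; Balaban1988Convergent, Thm 1 p.262] -/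
theorem record13SepCoPHInhabitedAx_of_texts_cofinalRadii (Tok : T4Family → ℕ → ℝ → Prop)
    (hBr : ∀ (F : T4Family) (Mc : ℕ) (a₀ : ℝ), Tok F Mc a₀ → TokP9L4Old F Mc a₀)
    (h8 : ∀ F, Sig8LR4 F) (h7 : ∀ F, Sig7With Tok F) (hA : ∀ F, JoinAntecedentsCofinalRadii Tok F)
    (h121 : ∀ (F : T4Family) (a₀ ε₂₉ γ : ℝ), 0 < a₀ → 0 < ε₂₉ → 0 < γ → γ ≤ 1 / 2 → RecordPolLimitOnRunsAx F a₀ ε₂₉ γ) :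
    Summit.QuantumFields.YangMills.Theses.BalabanUVNodes.Record13SepCoPHInhabitedAx :=
  record13SepCoPHInhabitedAx_of_k0PiDecayCofinalRadiiAx (k0PiDecayCofinalRadiiAx_of_texts_cofinalRadii Tok hBr h8 h7 hA h121)

/-! ## §3  ★★ THE CENSUS: ten of the thirteen antecedents are tree theorems on cofinally small radii; three residual tokens -/

/-- ★★ **THE RESIDUAL ON THE JOIN NODE** — for every token `Tok` and family `F`: (R-Uk) [15] Thm 1's existence ∕ unique-orbit clause for the record's `U_k` at admissible
cut-off letters above a floor `M₀` and radii below a ceiling `aU`, (R-Bg) real-analyticity at `B = 0` of the record's background field (ceiling `aB`, floor `M₀`), (R-Tok) the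
locality token (ceiling `aT`, floor `M₀`) ⟹ the COFINAL-RADII supply `JoinAntecedentsCofinalRadii Tok F`.  The other ten conjuncts of `JoinAntecedents` are discharged: `McGuard`
(`Mc := L^e`, `e` above `Mth` and the three floors), stub 1ᴮ
PROVED (`prop8StepCoPGridGBAt_holds`, radius `a₀ := min (min a aS) (min aU (min aB aT))` by `of_le`), the Gauge-9 supplier on the green [6] Prop. 6 (`twoPrimeAx`), [15] Thm 1
(7)-regularity from (8)ᴮ.  The two residual TEXTS are conjuncts 11–12 of ▶ PTC-1's `JoinAntecedents` VERBATIM.  CONDITIONAL on the three tokens (displayed, inhabited nowhere);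
nothing of Bałaban asserted. [cite: Balaban1985Variational, Thm 1 (8)–(9) p.279, (7) p.278, Prop. 8 p.304, Prop. 9 p.309; Balaban1985RegularSpaces, Prop. 6 (1.135)–(1.138) p.99; Balaban1987RG1, Thm 1 p.259, (1.19) p.263, (2.3) p.265, p.257] -/
theorem joinAntecedentsCofinalRadii_of_residual (Tok : T4Family → ℕ → ℝ → Prop) (F : T4Family)
    (hUk : ∃ aU : ℝ, 0 < aU ∧ ∀ (B₃ a₀ a₁ : ℝ), 2 * (F.L : ℝ) ^ 2 ≤ B₃ → 0 < a₀ → a₀ ≤ aU → 0 < a₁ → ∃ M₀ : ℕ, ∀ Mc : ℕ, McGuard F Mc → M₀ ≤ Mc →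
      (∀ ε₁ : ℝ, 0 < ε₁ → ε₁ ≤ a₁ → B₃ * ε₁ ≤ a₀ → ∀ (k n : ℕ) (V : Literature.MathematicalPhysics.QuantumFieldTheory.Balaban1983to89.GaugeField (F.P (Summit.QuantumFields.YangMills.Theorems.K0RecordFormatNames.recordK₀ F Mc k + n)) (k + 1) (Literature.MathematicalPhysics.QuantumFieldTheory.Balaban1983to89.Node00.SU 2)), Literature.MathematicalPhysics.QuantumFieldTheory.Balaban1983to89.PlaqSmall ε₁ V → Literature.MathematicalPhysics.QuantumFieldTheory.Balaban1983to89.Node00.UkExists F 2 (Summit.QuantumFields.YangMills.Theorems.K0RecordFormatNames.recordK₀ F Mc k + n) (k + 1) a₀ V ∧ Literature.MathematicalPhysics.QuantumFieldTheory.Balaban1983to89.Node00.UniqueUkOrbit F 2 (Summit.QuantumFields.YangMills.Theorems.K0RecordFormatNames.recordK₀ F Mc k + n) (k + 1) a₀ V))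
    (hBg : ∃ aB : ℝ, 0 < aB ∧ ∀ a₀ : ℝ, 0 < a₀ → a₀ ≤ aB → ∃ M₀ : ℕ, ∀ Mc : ℕ, McGuard F Mc → M₀ ≤ Mc →
      (∀ (k n : ℕ) (ε₂₉ : ℝ), 0 < ε₂₉ → letI θ := Summit.QuantumFields.YangMills.Theorems.K0RecordFormatNames.thetaFill F a₀ ε₂₉; letI := θ.instVβ₁; letI := θ.instVβ₂; letI := θ.instιβ; AnalyticAt ℝ (fun B : Summit.QuantumFields.YangMills.Theorems.K0RecordFormatNames.recordW F a₀ ε₂₉ k (Summit.QuantumFields.YangMills.Theorems.K0RecordFormatNames.recordK₀ F Mc k + n) => fun (b : Literature.MathematicalPhysics.QuantumFieldTheory.Balaban1983to89.PBond (F.P (Summit.QuantumFields.YangMills.Theorems.K0RecordFormatNames.recordK₀ F Mc k + n)) 0) (i i' : Fin 2) => ((Summit.QuantumFields.YangMills.Theorems.K0RecordFormatNames.recordBgField F θ k (Summit.QuantumFields.YangMills.Theorems.K0RecordFormatNames.recordK₀ F Mc k + n) B b : Literature.MathematicalPhysics.QuantumFieldTheory.Balaban1983to89.Node00.SU 2)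 : Matrix (Fin 2) (Fin 2) ℂ) i i') 0))
    (hTok : ∃ aT : ℝ, 0 < aT ∧ ∀ a₀ : ℝ, 0 < a₀ → a₀ ≤ aT → ∃ M₀ : ℕ, ∀ Mc : ℕ, McGuard F Mc → M₀ ≤ Mc → Tok F Mc a₀) :
    JoinAntecedentsCofinalRadii Tok F := by
  obtain ⟨aU, haU, hUk⟩ := hUk
  obtain ⟨aB, haB, hBg⟩ := hBg
  obtain ⟨aT, haT, hTok⟩ := hTok
  intro Mth a ha
  obtain ⟨c, c₀, c₁, B₃, aS, a₁, hB₃, haS, ha₁, h8⟩ := prop8StepCoPGridGBAt_holds F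
  have ha₀ : 0 < min (min a aS) (min aU (min aB aT)) := lt_min (lt_min ha haS) (lt_min haU (lt_min haB haT))
  have ha₀a : min (min a aS) (min aU (min aB aT)) ≤ a := (min_le_left _ _).trans (min_le_left _ _)
  have ha₀S : min (min a aS) (min aU (min aB aT)) ≤ aS := (min_le_left _ _).trans (min_le_right _ _)
  have ha₀U : min (min a aS) (min aU (min aB aT)) ≤ aU := (min_le_right _ _).trans (min_le_left _ _)
  have ha₀B : min (min a aS) (min aU (min aB aT)) ≤ aB := (min_le_right _ _).trans ((min_le_right _ _).trans (min_le_left _ _))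
  have ha₀T : min (min a aS) (min aU (min aB aT)) ≤ aT := (min_le_right _ _).trans ((min_le_right _ _).trans (min_le_right _ _))
  generalize min (min a aS) (min aU (min aB aT)) = a₀ at ha₀ ha₀a ha₀S ha₀U ha₀B ha₀T
  have h8a := h8.of_le ha₀S le_rfl
  have hL : (0 : ℝ) < (F.L : ℝ) := by exact_mod_cast lt_trans Nat.zero_lt_one F.hL.2
  have hBpos : (0 : ℝ) < B₃ := lt_of_lt_of_le (mul_pos two_pos (pow_pos hL 2)) hB₃
  obtain ⟨j, c', B₉, a₁', hcc', hc', hc₀, hc₁, hB₉, ha₁', ha₁'le, h9⟩ :=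
    gauge9SupplierG3B_of_prop6MemberP F (twoPrimeAx F) (lamDatum F) (dataSmall7LamTopOf F 2) c c₀ c₁ B₃ a₀ a₁ hB₃ ha₀ ha₁ h8a
  have h15 : VariationalThm1RegSepCoP7MGB F 2 (fun ν M g K k _s => c' ≤ ν.M₁ ∧ k + c₀ ≤ F.m + K ∧ F.L ^ c₁ ∣ M ∧
      ∀ i, 1 ≤ i → i ≤ k → dCubeSide (F.P K).L M (RkOfRecord (F.P K).L ν.r (g i)) i ∣ (F.P K).sitesPerDir 0) (lamDatum F) (dataSmall7LamTopOf F 2) B₃ a₀ a₁' :=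
    (variationalThm1RegSepCoP7MGB_of_prop8TopStepGB_lamDatum hBpos (h8a.of_le le_rfl ha₁'le)).of_imp fun _ _ _ _ _ _ h => ⟨hcc'.trans h.1, h.2⟩
  obtain ⟨MU, hU⟩ := hUk B₃ a₀ a₁' hB₃ ha₀ ha₀U ha₁'
  obtain ⟨MB, hB⟩ := hBg a₀ ha₀ ha₀B
  obtain ⟨MT, hT⟩ := hTok a₀ ha₀ ha₀T
  have he : ∀ n : ℕ, n ≤ max Mth (max MU (max MB MT)) → n ≤ F.L ^ max Mth (max MU (max MB MT)) :=
    fun n hn => hn.trans (Nat.lt_pow_self F.hL.2).le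
  have hG : McGuard F (F.L ^ max Mth (max MU (max MB MT))) := mcGuard_pow F _
  refine ⟨a₀, ha₀, ha₀a, F.L ^ max Mth (max MU (max MB MT)), he Mth (le_max_left _ _), j, c', c₀, c₁, B₃, B₉, a₁', ?_⟩
  unfold JoinAntecedents
  exact ⟨hG, hc', hc₀, hc₁, hB₃, hB₉, ha₀, ha₁', h15, h9,
    hU _ hG (he MU ((le_max_left _ _).trans (le_max_right _ _))),
    hB _ hG (he MB (((le_max_left _ _).trans (le_max_right _ _)).trans (le_max_right _ _))),
    hT _ hG (he MT (((le_max_right _ _).trans (le_max_right _ _)).trans (le_max_right _ _)))⟩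

/-! ## §4  ★★★ K0ᴬ BY NAME with the residual DISPLAYED ONE TOKEN AT A TIME (token-parametric); ☆ the IMPLICATION-ONLY instance at the SIGNED v11-G₄ text -/

/-- ★★★ **K0ᴬ BY NAME, EVERY TOKEN**: ⁸ ∧ a ⁷-shaped text (`Tok ⟹ TokP9L4Old`) ∧ (R-Uk) ∧ (R-Bg) ∧ (R-Tok) per family ∧ the (1.21)-Ax run letter ⟹ `Record13SepCoPHInhabitedAx`.
TOKEN-PARAMETRIC: the consumer-in-waiting for the corrected locality token T‴ (№508 (2)(iii), `Sig7V12`-shaped helper Prop).  CONDITIONAL helper; K0ᴬ OPEN; nothing of Bałaban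
discharged; the mass gap is NOT proved.
[cite: Balaban1987RG1, Thm 1 p.259, Thm 3 p.264, (1.19)–(1.22) pp.263–264, (5.10) p.293; Balaban1985Variational, Thm 1 (8)–(9) p.279, Prop. 9 p.309; Balaban1988Convergent, Thm 1 p.262] -/
theorem record13SepCoPHInhabitedAx_of_texts_residual (Tok : T4Family → ℕ → ℝ → Prop)
    (hBr : ∀ (F : T4Family) (Mc : ℕ) (a₀ : ℝ), Tok F Mc a₀ → TokP9L4Old F Mc a₀)
    (h8 : ∀ F, Sig8LR4 F) (h7 : ∀ F, Sig7With Tok F)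
    (hUk : ∀ F : T4Family, ∃ aU : ℝ, 0 < aU ∧ ∀ (B₃ a₀ a₁ : ℝ), 2 * (F.L : ℝ) ^ 2 ≤ B₃ → 0 < a₀ → a₀ ≤ aU → 0 < a₁ → ∃ M₀ : ℕ, ∀ Mc : ℕ, McGuard F Mc → M₀ ≤ Mc →
      (∀ ε₁ : ℝ, 0 < ε₁ → ε₁ ≤ a₁ → B₃ * ε₁ ≤ a₀ → ∀ (k n : ℕ) (V : Literature.MathematicalPhysics.QuantumFieldTheory.Balaban1983to89.GaugeField (F.P (Summit.QuantumFields.YangMills.Theorems.K0RecordFormatNames.recordK₀ F Mc k + n)) (k + 1) (Literature.MathematicalPhysics.QuantumFieldTheory.Balaban1983to89.Node00.SU 2)), Literature.MathematicalPhysics.QuantumFieldTheory.Balaban1983to89.PlaqSmall ε₁ V → Literature.MathematicalPhysics.QuantumFieldTheory.Balaban1983to89.Node00.UkExists F 2 (Summit.QuantumFields.YangMills.Theorems.K0RecordFormatNames.recordK₀ F Mc k + n) (k + 1) a₀ V ∧ Literature.MathematicalPhysics.QuantumFieldTheory.Balaban1983to89.Node00.UniqueUkOrbit F 2 (Summit.QuantumFields.YangMills.Theorems.K0RecordFormatNames.recordK₀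 F Mc k + n) (k + 1) a₀ V))
    (hBg : ∀ F : T4Family, ∃ aB : ℝ, 0 < aB ∧ ∀ a₀ : ℝ, 0 < a₀ → a₀ ≤ aB → ∃ M₀ : ℕ, ∀ Mc : ℕ, McGuard F Mc → M₀ ≤ Mc →
      (∀ (k n : ℕ) (ε₂₉ : ℝ), 0 < ε₂₉ → letI θ := Summit.QuantumFields.YangMills.Theorems.K0RecordFormatNames.thetaFill F a₀ ε₂₉; letI := θ.instVβ₁; letI := θ.instVβ₂; letI := θ.instιβ; AnalyticAt ℝ (fun B : Summit.QuantumFields.YangMills.Theorems.K0RecordFormatNames.recordW F a₀ ε₂₉ k (Summit.QuantumFields.YangMills.Theorems.K0RecordFormatNames.recordK₀ F Mc k + n) => fun (b : Literature.MathematicalPhysics.QuantumFieldTheory.Balaban1983to89.PBond (F.P (Summit.QuantumFields.YangMills.Theorems.K0RecordFormatNames.recordK₀ F Mc k + n)) 0) (i i' : Fin 2) => ((Summit.QuantumFields.YangMills.Theorems.K0RecordFormatNames.recordBgField F θ k (Summit.QuantumFields.YangMills.Theorems.K0RecordFormatNames.recordK₀ F Mc k + n) B b : Literature.MathematicalPhysics.QuantumFieldTheory.Balaban1983to89.Node00.SU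 2) : Matrix (Fin 2) (Fin 2) ℂ) i i') 0))
    (hTok : ∀ F : T4Family, ∃ aT : ℝ, 0 < aT ∧ ∀ a₀ : ℝ, 0 < a₀ → a₀ ≤ aT → ∃ M₀ : ℕ, ∀ Mc : ℕ, McGuard F Mc → M₀ ≤ Mc → Tok F Mc a₀)
    (h121 : ∀ (F : T4Family) (a₀ ε₂₉ γ : ℝ), 0 < a₀ → 0 < ε₂₉ → 0 < γ → γ ≤ 1 / 2 → RecordPolLimitOnRunsAx F a₀ ε₂₉ γ) :
    Summit.QuantumFields.YangMills.Theses.BalabanUVNodes.Record13SepCoPHInhabitedAx :=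
  record13SepCoPHInhabitedAx_of_texts_cofinalRadii Tok hBr h8 h7
    (fun F => joinAntecedentsCofinalRadii_of_residual Tok F (hUk F) (hBg F) (hTok F)) h121

/-- ☆ **THE INSTANCE AT THE SIGNED v11-G₄ TEXT of stmt-QuantumFields-27931** (`Sig7V11G4` bca3cb0d9af367ce; token `TokP9L4New ∧ TokRest4`, `TokRest4 ↔ Tok182 ∧ TokCmpUcap`).
**IMPLICATION-ONLY (★★★ №508, 04:50:26Z): the displayed hypothesis `h182` is FALSE-SHAPED AS CUT (▶ PTZ-1 O-Tok182 memo v1 39afd2c5c054e08c + ◆ CRIT-1 04:49:39Z; class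
FALSE-SHAPED · KERNEL-UNDECIDABLE; no `¬Tok182` claimed) ⇒ NOT CONSUMABLE toward K0ᴬ; kept as the typed location of the break on the G₄ road (one token of five).**
⁸ ∧ ⁷-G₄ ∧ (R-Uk) ∧ (R-Bg) ∧ (R-‴) ∧ (R-182) ∧ (R-cmpU) ∧ the (1.21)-Ax run letter ⟹ K0ᴬ BY NAME — W-UDR's residual on the JOIN node displayed one Bałaban token at a
time (each below its own radius ceiling and above its own cut-off floor, at admissible `Mc = L^e`).  CONDITIONAL helper; K0ᴬ OPEN; nothing of Bałaban discharged; the mass gap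
is NOT proved.
[cite: Balaban1987RG1, Thm 1 p.259, Thm 3 p.264, (5.10) p.293; Balaban1985Variational, Thm 1 (8)–(9) p.279, Prop. 9 p.309, (182) p.307, (190) p.308] -/
theorem record13SepCoPHInhabitedAx_of_textsG4_residual
    (h8 : ∀ F, Sig8LR4 F) (h7 : ∀ F, Sig7V11G4 F)
    (hUk : ∀ F : T4Family, ∃ aU : ℝ, 0 < aU ∧ ∀ (B₃ a₀ a₁ : ℝ), 2 * (F.L : ℝ) ^ 2 ≤ B₃ → 0 < a₀ → a₀ ≤ aU → 0 < a₁ → ∃ M₀ : ℕ, ∀ Mc : ℕ, McGuard F Mc → M₀ ≤ Mc →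
      (∀ ε₁ : ℝ, 0 < ε₁ → ε₁ ≤ a₁ → B₃ * ε₁ ≤ a₀ → ∀ (k n : ℕ) (V : Literature.MathematicalPhysics.QuantumFieldTheory.Balaban1983to89.GaugeField (F.P (Summit.QuantumFields.YangMills.Theorems.K0RecordFormatNames.recordK₀ F Mc k + n)) (k + 1) (Literature.MathematicalPhysics.QuantumFieldTheory.Balaban1983to89.Node00.SU 2)), Literature.MathematicalPhysics.QuantumFieldTheory.Balaban1983to89.PlaqSmall ε₁ V → Literature.MathematicalPhysics.QuantumFieldTheory.Balaban1983to89.Node00.UkExists F 2 (Summit.QuantumFields.YangMills.Theorems.K0RecordFormatNames.recordK₀ F Mc k + n) (k + 1) a₀ V ∧ Literature.MathematicalPhysics.QuantumFieldTheory.Balaban1983to89.Node00.UniqueUkOrbit F 2 (Summit.QuantumFields.YangMills.Theorems.K0RecordFormatNames.recordK₀ F Mc k + n) (k + 1) a₀ V))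
    (hBg : ∀ F : T4Family, ∃ aB : ℝ, 0 < aB ∧ ∀ a₀ : ℝ, 0 < a₀ → a₀ ≤ aB → ∃ M₀ : ℕ, ∀ Mc : ℕ, McGuard F Mc → M₀ ≤ Mc →
      (∀ (k n : ℕ) (ε₂₉ : ℝ), 0 < ε₂₉ → letI θ := Summit.QuantumFields.YangMills.Theorems.K0RecordFormatNames.thetaFill F a₀ ε₂₉; letI := θ.instVβ₁; letI := θ.instVβ₂; letI := θ.instιβ; AnalyticAt ℝ (fun B : Summit.QuantumFields.YangMills.Theorems.K0RecordFormatNames.recordW F a₀ ε₂₉ k (Summit.QuantumFields.YangMills.Theorems.K0RecordFormatNames.recordK₀ F Mc k + n) => fun (b : Literature.MathematicalPhysics.QuantumFieldTheory.Balaban1983to89.PBond (F.P (Summit.QuantumFields.YangMills.Theorems.K0RecordFormatNames.recordK₀ F Mc k + n)) 0) (i i' : Fin 2) => ((Summit.QuantumFields.YangMills.Theorems.K0RecordFormatNames.recordBgField F θ k (Summit.QuantumFields.YangMills.Theorems.K0RecordFormatNames.recordK₀ F Mc k + n) B b : Literature.MathematicalPhysics.QuantumFieldTheory.Balaban1983to89.Node00.SU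 2) : Matrix (Fin 2) (Fin 2) ℂ) i i') 0))
    (hP9 : ∀ F : T4Family, ∃ aP : ℝ, 0 < aP ∧ ∀ a₀ : ℝ, 0 < a₀ → a₀ ≤ aP → ∃ M₀ : ℕ, ∀ Mc : ℕ, McGuard F Mc → M₀ ≤ Mc → TokP9L4New F Mc a₀)
    (h182 : ∀ F : T4Family, ∃ aI : ℝ, 0 < aI ∧ ∀ a₀ : ℝ, 0 < a₀ → a₀ ≤ aI → ∃ M₀ : ℕ, ∀ Mc : ℕ, McGuard F Mc → M₀ ≤ Mc → Tok182 F Mc a₀)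
    (hcmpU : ∀ F : T4Family, ∃ aC : ℝ, 0 < aC ∧ ∀ a₀ : ℝ, 0 < a₀ → a₀ ≤ aC → ∃ M₀ : ℕ, ∀ Mc : ℕ, McGuard F Mc → M₀ ≤ Mc → TokCmpUcap F Mc a₀)
    (h121 : ∀ (F : T4Family) (a₀ ε₂₉ γ : ℝ), 0 < a₀ → 0 < ε₂₉ → 0 < γ → γ ≤ 1 / 2 → RecordPolLimitOnRunsAx F a₀ ε₂₉ γ) :
    Summit.QuantumFields.YangMills.Theses.BalabanUVNodes.Record13SepCoPHInhabitedAx := by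
  refine record13SepCoPHInhabitedAx_of_texts_residual _ (fun F Mc a₀ h => tokP9L4Old_of_new F Mc a₀ h.1) h8
    (fun F => sig7With_of_sig7V11G4 F (h7 F)) hUk hBg (fun F => ?_) h121
  obtain ⟨aP, haP, hP⟩ := hP9 F
  obtain ⟨aI, haI, hI⟩ := h182 F
  obtain ⟨aC, haC, hC⟩ := hcmpU F
  refine ⟨min aP (min aI aC), lt_min haP (lt_min haI haC), fun a₀ ha₀ hle => ?_⟩
  obtain ⟨MP, hP'⟩ := hP a₀ ha₀ (hle.trans (min_le_left _ _))
  obtain ⟨MI, hI'⟩ := hI a₀ ha₀ (hle.trans ((min_le_right _ _).trans (min_le_left _ _)))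
  obtain ⟨MC, hC'⟩ := hC a₀ ha₀ (hle.trans ((min_le_right _ _).trans (min_le_right _ _)))
  refine ⟨max MP (max MI MC), fun Mc hG hM => ⟨hP' Mc hG ((le_max_left _ _).trans hM), ?_⟩⟩
  exact (tokRest4_iff F Mc a₀).2 ⟨hI' Mc hG (((le_max_left _ _).trans (le_max_right _ _)).trans hM),
    hC' Mc hG (((le_max_right _ _).trans (le_max_right _ _)).trans hM)⟩

/-- ☆ **THE G₄ INSTANCE WITH THE (1.21)-Ax LETTER IN WINDOW-½ FORM** (`PolLimitsExist … (Window ½)` per `(F, a₀, ε₂₉)`, the (D4)∕K3ᴬ currency; `run121_of_window121`).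
**IMPLICATION-ONLY (№508): displayed hypothesis `h182` FALSE-SHAPED AS CUT ⇒ NOT consumable.**  CONDITIONAL helper; K0ᴬ OPEN; the mass gap is NOT proved.
[cite: Balaban1987RG1, Thm 1 p.259, Thm 3 p.264, (1.21) p.264, (5.10) p.293; Balaban1985Variational, Thm 1 p.279, Prop. 9 p.309] -/
theorem record13SepCoPHInhabitedAx_of_textsG4_residual_window
    (h8 : ∀ F, Sig8LR4 F) (h7 : ∀ F, Sig7V11G4 F)
    (hUk : ∀ F : T4Family, ∃ aU : ℝ, 0 < aU ∧ ∀ (B₃ a₀ a₁ : ℝ), 2 * (F.L : ℝ) ^ 2 ≤ B₃ → 0 < a₀ → a₀ ≤ aU → 0 < a₁ → ∃ M₀ : ℕ, ∀ Mc : ℕ, McGuard F Mc → M₀ ≤ Mc →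
      (∀ ε₁ : ℝ, 0 < ε₁ → ε₁ ≤ a₁ → B₃ * ε₁ ≤ a₀ → ∀ (k n : ℕ) (V : Literature.MathematicalPhysics.QuantumFieldTheory.Balaban1983to89.GaugeField (F.P (Summit.QuantumFields.YangMills.Theorems.K0RecordFormatNames.recordK₀ F Mc k + n)) (k + 1) (Literature.MathematicalPhysics.QuantumFieldTheory.Balaban1983to89.Node00.SU 2)), Literature.MathematicalPhysics.QuantumFieldTheory.Balaban1983to89.PlaqSmall ε₁ V → Literature.MathematicalPhysics.QuantumFieldTheory.Balaban1983to89.Node00.UkExists F 2 (Summit.QuantumFields.YangMills.Theorems.K0RecordFormatNames.recordK₀ F Mc k + n) (k + 1) a₀ V ∧ Literature.MathematicalPhysics.QuantumFieldTheory.Balaban1983to89.Node00.UniqueUkOrbit F 2 (Summit.QuantumFields.YangMills.Theorems.K0RecordFormatNames.recordK₀ F Mc k + n) (k + 1) a₀ V))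
    (hBg : ∀ F : T4Family, ∃ aB : ℝ, 0 < aB ∧ ∀ a₀ : ℝ, 0 < a₀ → a₀ ≤ aB → ∃ M₀ : ℕ, ∀ Mc : ℕ, McGuard F Mc → M₀ ≤ Mc →
      (∀ (k n : ℕ) (ε₂₉ : ℝ), 0 < ε₂₉ → letI θ := Summit.QuantumFields.YangMills.Theorems.K0RecordFormatNames.thetaFill F a₀ ε₂₉; letI := θ.instVβ₁; letI := θ.instVβ₂; letI := θ.instιβ; AnalyticAt ℝ (fun B : Summit.QuantumFields.YangMills.Theorems.K0RecordFormatNames.recordW F a₀ ε₂₉ k (Summit.QuantumFields.YangMills.Theorems.K0RecordFormatNames.recordK₀ F Mc k + n) => fun (b : Literature.MathematicalPhysics.QuantumFieldTheory.Balaban1983to89.PBond (F.P (Summit.QuantumFields.YangMills.Theorems.K0RecordFormatNames.recordK₀ F Mc k + n)) 0) (i i' : Fin 2) => ((Summit.QuantumFields.YangMills.Theorems.K0RecordFormatNames.recordBgField F θ k (Summit.QuantumFields.YangMills.Theorems.K0RecordFormatNames.recordK₀ F Mc k + n) B b : Literature.MathematicalPhysics.QuantumFieldTheory.Balaban1983to89.Node00.SU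 2) : Matrix (Fin 2) (Fin 2) ℂ) i i') 0))
    (hP9 : ∀ F : T4Family, ∃ aP : ℝ, 0 < aP ∧ ∀ a₀ : ℝ, 0 < a₀ → a₀ ≤ aP → ∃ M₀ : ℕ, ∀ Mc : ℕ, McGuard F Mc → M₀ ≤ Mc → TokP9L4New F Mc a₀)
    (h182 : ∀ F : T4Family, ∃ aI : ℝ, 0 < aI ∧ ∀ a₀ : ℝ, 0 < a₀ → a₀ ≤ aI → ∃ M₀ : ℕ, ∀ Mc : ℕ, McGuard F Mc → M₀ ≤ Mc → Tok182 F Mc a₀)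
    (hcmpU : ∀ F : T4Family, ∃ aC : ℝ, 0 < aC ∧ ∀ a₀ : ℝ, 0 < a₀ → a₀ ≤ aC → ∃ M₀ : ℕ, ∀ Mc : ℕ, McGuard F Mc → M₀ ≤ Mc → TokCmpUcap F Mc a₀)
    (hW : ∀ (F : T4Family) (a₀ ε₂₉ : ℝ), 0 < a₀ → 0 < ε₂₉ →
      letI θ := thetaFill F a₀ ε₂₉
      letI := θ.instVβ₁; letI := θ.instVβ₂; letI := θ.instιβ
      PolLimitsExist F (recordTermsAx F a₀ ε₂₉) θ.ρ8 θ.bV (Window (1 / 2))) :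
    Summit.QuantumFields.YangMills.Theses.BalabanUVNodes.Record13SepCoPHInhabitedAx :=
  record13SepCoPHInhabitedAx_of_textsG4_residual h8 h7 hUk hBg hP9 h182 hcmpU fun F => run121_of_window121 F (hW F)

/-! ## §5  ★★★ The `h121`-FREE edition over ▶ PTC-1's §5 `JoinConclLimR` (◇ lens-1 SCOPE FLAG ∕ docket O-11) -/

/-- ★ **COFINAL-RADII supply ∧ `JoinConclLimR` ⟹ W-UDR-Ax** `K0PiDecayCofinalRadiiAx` — ▶ PTC-1's `decayLetter_of_lim` read ONE radius `a₀ ≤ a` at a time (level `min γ₀ ½`; the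
(1.21) limit never leaves the JOIN's own scope).  CONDITIONAL on the two displayed shapes; nothing of [I] discharged. [cite: Balaban1987RG1, Thm 1 p.259, Thm 3 p.264, (1.21)–(1.22) p.264, (5.10) p.293] -/
theorem k0PiDecayCofinalRadiiAx_of_lim_cofinalRadii (Tok : T4Family → ℕ → ℝ → Prop)
    (hA : ∀ F, JoinAntecedentsCofinalRadii Tok F) (hL : ∀ F, JoinConclLimR Tok F) : K0PiDecayCofinalRadiiAx := by
  intro F a ha
  obtain ⟨Mth, hJ⟩ := hL F
  obtain ⟨a₀, ha₀, hle, Mc, hMc, j, c, c₀, c₁, B₃, B₃', a₁, hAnt⟩ := hA F Mth a ha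
  obtain ⟨γ₀, ε₂₉, C, δ₁, hγ₀, hε, hboth⟩ := hJ Mc hMc j c c₀ c₁ B₃ B₃' a₀ a₁ hAnt
  exact ⟨a₀, ha₀, hle, min γ₀ (1 / 2), ε₂₉, C, δ₁, lt_min hγ₀ (by norm_num), min_le_right _ _, hε, (hboth _ (min_le_left _ _)).2⟩

/-- ★★★ **K0ᴬ BY NAME, `h121`-FREE, EVERY TOKEN**: O-11's radius-uniform JOIN consequent `JoinConclLimR Tok F` (to be supplied from ⁸ ∧ ⁷ by the limit twin — NOT here) ∧ (R-Uk) ∧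
(R-Bg) ∧ (R-Tok) per family ⟹ `Record13SepCoPHInhabitedAx`.  The whole residual on the JOIN node once O-11 lands: P0 at the record (two displayed outputs) + one locality token.
CONDITIONAL helper; K0ᴬ OPEN; nothing of Bałaban discharged; the mass gap is NOT proved.
[cite: Balaban1987RG1, Thm 1 p.259, Thm 3 p.264, (1.21)–(1.22) p.264, (5.10) p.293, (5.42) p.297; Balaban1985Variational, Thm 1 (8)–(9) p.279, Prop. 9 p.309; Balaban1988Convergent, Thm 1 p.262] -/
theorem record13SepCoPHInhabitedAx_of_lim_residual (Tok : T4Family → ℕ → ℝ → Prop) (hL : ∀ F, JoinConclLimR Tok F)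
    (hUk : ∀ F : T4Family, ∃ aU : ℝ, 0 < aU ∧ ∀ (B₃ a₀ a₁ : ℝ), 2 * (F.L : ℝ) ^ 2 ≤ B₃ → 0 < a₀ → a₀ ≤ aU → 0 < a₁ → ∃ M₀ : ℕ, ∀ Mc : ℕ, McGuard F Mc → M₀ ≤ Mc →
      (∀ ε₁ : ℝ, 0 < ε₁ → ε₁ ≤ a₁ → B₃ * ε₁ ≤ a₀ → ∀ (k n : ℕ) (V : Literature.MathematicalPhysics.QuantumFieldTheory.Balaban1983to89.GaugeField (F.P (Summit.QuantumFields.YangMills.Theorems.K0RecordFormatNames.recordK₀ F Mc k + n)) (k + 1) (Literature.MathematicalPhysics.QuantumFieldTheory.Balaban1983to89.Node00.SU 2)), Literature.MathematicalPhysics.QuantumFieldTheory.Balaban1983to89.PlaqSmall ε₁ V → Literature.MathematicalPhysics.QuantumFieldTheory.Balaban1983to89.Node00.UkExists F 2 (Summit.QuantumFields.YangMills.Theorems.K0RecordFormatNames.recordK₀ F Mc k + n) (k + 1) a₀ V ∧ Literature.MathematicalPhysics.QuantumFieldTheory.Balaban1983to89.Node00.UniqueUkOrbit F 2 (Summit.QuantumFields.YangMills.Theorems.K0RecordFormatNames.recordK₀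 F Mc k + n) (k + 1) a₀ V))
    (hBg : ∀ F : T4Family, ∃ aB : ℝ, 0 < aB ∧ ∀ a₀ : ℝ, 0 < a₀ → a₀ ≤ aB → ∃ M₀ : ℕ, ∀ Mc : ℕ, McGuard F Mc → M₀ ≤ Mc →
      (∀ (k n : ℕ) (ε₂₉ : ℝ), 0 < ε₂₉ → letI θ := Summit.QuantumFields.YangMills.Theorems.K0RecordFormatNames.thetaFill F a₀ ε₂₉; letI := θ.instVβ₁; letI := θ.instVβ₂; letI := θ.instιβ; AnalyticAt ℝ (fun B : Summit.QuantumFields.YangMills.Theorems.K0RecordFormatNames.recordW F a₀ ε₂₉ k (Summit.QuantumFields.YangMills.Theorems.K0RecordFormatNames.recordK₀ F Mc k + n) => fun (b : Literature.MathematicalPhysics.QuantumFieldTheory.Balaban1983to89.PBond (F.P (Summit.QuantumFields.YangMills.Theorems.K0RecordFormatNames.recordK₀ F Mc k + n)) 0) (i i' : Fin 2) => ((Summit.QuantumFields.YangMills.Theorems.K0RecordFormatNames.recordBgField F θ k (Summit.QuantumFields.YangMills.Theorems.K0RecordFormatNames.recordK₀ F Mc k + n) B b : Literature.MathematicalPhysics.QuantumFieldTheory.Balaban1983to89.Node00.SU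 2) : Matrix (Fin 2) (Fin 2) ℂ) i i') 0))
    (hTok : ∀ F : T4Family, ∃ aT : ℝ, 0 < aT ∧ ∀ a₀ : ℝ, 0 < a₀ → a₀ ≤ aT → ∃ M₀ : ℕ, ∀ Mc : ℕ, McGuard F Mc → M₀ ≤ Mc → Tok F Mc a₀) :
    Summit.QuantumFields.YangMills.Theses.BalabanUVNodes.Record13SepCoPHInhabitedAx :=
  record13SepCoPHInhabitedAx_of_k0PiDecayCofinalRadiiAx (k0PiDecayCofinalRadiiAx_of_lim_cofinalRadii Tok
    (fun F => joinAntecedentsCofinalRadii_of_residual Tok F (hUk F) (hBg F) (hTok F)) hL)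

/-! ## §6  (P3 g88 addendum, LENS P3) The token is a CUT POINT: monotonicity in `Tok`, and the TOKEN-FREE door -/

/-- `JoinAntecedents` is MONOTONE in the token (its 13th conjunct is `Tok F Mc a₀`; the other twelve do not mention `Tok`). [cite: Balaban1987RG1, Thm 1 p.259, (1.19) p.263; Balaban1985Variational, Thm 1 p.279, Prop. 9 p.309] -/
theorem joinAntecedents_mono_tok {Tok₁ Tok₂ : T4Family → ℕ → ℝ → Prop} (h : ∀ (F : T4Family) (Mc : ℕ) (a₀ : ℝ), Tok₁ F Mc a₀ → Tok₂ F Mc a₀)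
    {F : T4Family} {Mc j c c₀ c₁ : ℕ} {B₃ B₃' a₀ a₁ : ℝ} (hJ : JoinAntecedents Tok₁ F Mc j c c₀ c₁ B₃ B₃' a₀ a₁) :
    JoinAntecedents Tok₂ F Mc j c c₀ c₁ B₃ B₃' a₀ a₁ := by
  unfold JoinAntecedents at hJ ⊢
  obtain ⟨h1, h2, h3, h4, h5, h6, h7, h8, h9, h10, h11, h12, h13⟩ := hJ
  exact ⟨h1, h2, h3, h4, h5, h6, h7, h8, h9, h10, h11, h12, h _ _ _ h13⟩

/-- `JoinConclLimR` is ANTITONE in the token: a WEAKER token makes the radius-uniform limit-join a STRONGER statement (the token sits among the antecedents).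
[cite: Balaban1987RG1, Thm 1 p.259, (1.21)–(1.22) p.264, (5.10) p.293] -/
theorem joinConclLimR_antitone_tok {Tok₁ Tok₂ : T4Family → ℕ → ℝ → Prop} (h : ∀ (F : T4Family) (Mc : ℕ) (a₀ : ℝ), Tok₂ F Mc a₀ → Tok₁ F Mc a₀)
    {F : T4Family} (hL : JoinConclLimR Tok₁ F) : JoinConclLimR Tok₂ F := by
  obtain ⟨Mth, hM⟩ := hL
  exact ⟨Mth, fun Mc hMc j c c₀ c₁ B₃ B₃' a₀ a₁ hA => hM Mc hMc j c c₀ c₁ B₃ B₃' a₀ a₁ (joinAntecedents_mono_tok h hA)⟩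

/-- The TOKEN-FREE limit-join (`Tok := ⊤`) is the STRONGEST: it implies `JoinConclLimR Tok F` for every token. [cite: Balaban1987RG1, Thm 1 p.259, (1.21)–(1.22) p.264] -/
theorem joinConclLimR_of_tokFree {Tok : T4Family → ℕ → ℝ → Prop} {F : T4Family} (hL : JoinConclLimR (fun _ _ _ => True) F) : JoinConclLimR Tok F :=
  joinConclLimR_antitone_tok (fun _ _ _ _ => trivial) hL

/-- The cofinal-radii SUPPLY is MONOTONE in the token (opposite variance to `JoinConclLimR`: the token is a cut point between supplier and consumer).
[cite: Balaban1987RG1, Thm 1 p.259, (1.19) p.263; Balaban1985Variational, Thm 1 p.279] -/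
theorem joinAntecedentsCofinalRadii_mono_tok {Tok₁ Tok₂ : T4Family → ℕ → ℝ → Prop} (h : ∀ (F : T4Family) (Mc : ℕ) (a₀ : ℝ), Tok₁ F Mc a₀ → Tok₂ F Mc a₀)
    {F : T4Family} (hA : JoinAntecedentsCofinalRadii Tok₁ F) : JoinAntecedentsCofinalRadii Tok₂ F := by
  intro Mth a ha
  obtain ⟨a₀, ha₀, hle, Mc, hMc, j, c, c₀, c₁, B₃, B₃', a₁, hJ⟩ := hA Mth a ha
  exact ⟨a₀, ha₀, hle, Mc, hMc, j, c, c₀, c₁, B₃, B₃', a₁, joinAntecedents_mono_tok h hJ⟩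

/-- ★ **CUT COMPOSITION**: a supplier delivering the antecedents at a token `TokS` and a consumer proving the limit-join at a token `TokC` COMPOSE to W-UDR-Ax whenever
`TokS ⟹ TokC` (the supplier may over-deliver, the consumer may under-ask).  CONDITIONAL on the two displayed shapes. [cite: Balaban1987RG1, Thm 1 p.259, Thm 3 p.264, (1.21)–(1.22) p.264, (5.10) p.293] -/
theorem k0PiDecayCofinalRadiiAx_of_cut {TokS TokC : T4Family → ℕ → ℝ → Prop} (h : ∀ (F : T4Family) (Mc : ℕ) (a₀ : ℝ), TokS F Mc a₀ → TokC F Mc a₀)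
    (hA : ∀ F : T4Family, JoinAntecedentsCofinalRadii TokS F) (hL : ∀ F : T4Family, JoinConclLimR TokC F) :
    Summit.QuantumFields.YangMills.Theorems.K0V23Stub3CofinalRunDoorAx.K0PiDecayCofinalRadiiAx :=
  k0PiDecayCofinalRadiiAx_of_lim_cofinalRadii TokC (fun F => joinAntecedentsCofinalRadii_mono_tok h (hA F)) hL

/-- ★ **CUT COMPOSITION AT K0ᴬ**: the same, concluded BY NAME. [cite: Balaban1987RG1, Thm 1 p.259, Thm 3 p.264, (1.21)–(1.22) p.264; Balaban1988Convergent, Thm 1 p.262] -/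
theorem record13SepCoPHInhabitedAx_of_cut {TokS TokC : T4Family → ℕ → ℝ → Prop} (h : ∀ (F : T4Family) (Mc : ℕ) (a₀ : ℝ), TokS F Mc a₀ → TokC F Mc a₀)
    (hA : ∀ F : T4Family, JoinAntecedentsCofinalRadii TokS F) (hL : ∀ F : T4Family, JoinConclLimR TokC F) :
    Summit.QuantumFields.YangMills.Theses.BalabanUVNodes.Record13SepCoPHInhabitedAx :=
  Summit.QuantumFields.YangMills.Theorems.K0V23Stub3CofinalRunDoorAx.record13SepCoPHInhabitedAx_of_k0PiDecayCofinalRadiiAx (k0PiDecayCofinalRadiiAx_of_cut h hA hL)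

/-- ★★★ **THE TOKEN-FREE DOOR (LENS P3: the weakest typed door on the JOIN road displays NO response-decay token of any form)**: `(∀ F, JoinConclLimR ⊤ F)` — «at cofinally admissible
cut-offs `Mc`, the twelve regularity ∕ gauge antecedents of the JOIN ⟹ ∃ γ₀ ε₂₉ C δ₁, the (1.21)-limit AND the decay of the limit activities on runs» — ∧ (R-Uk) ∧ (R-Bg) ⟹ K0ᴬ BY NAME.
No `recordHr`, no Tok-182, no ‴ of either form is displayed: a false-shaped gauge-fixed intermediate (★★★ №508; ★★ DEF-1 g35's TUBE finding, ◆'s verdict pending) can sit only INSIDE a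
proof of `hL`, never in this door's hypotheses.  CONDITIONAL helper: `JoinConclLimR ⊤` is [I] (1.21) + (4.35)-strength Bałaban content, asked directly; (R-Uk) ∧ (R-Bg) = P0 at the record;
nothing is discharged; K0ᴬ OPEN; the mass gap is NOT proved.
[cite: Balaban1987RG1, Thm 1 p.259, Thm 3 p.264, (1.21)–(1.22) p.264, (4.35) p.290, (5.10) p.293; Balaban1985Variational, Thm 1 (8)–(9) p.279; Balaban1988Convergent, Thm 1 p.262] -/
theorem record13SepCoPHInhabitedAx_of_lim_residual_tokFree (hL : ∀ F : T4Family, JoinConclLimR (fun _ _ _ => True) F)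
    (hUk : ∀ F : T4Family, ∃ aU : ℝ, 0 < aU ∧ ∀ (B₃ a₀ a₁ : ℝ), 2 * (F.L : ℝ) ^ 2 ≤ B₃ → 0 < a₀ → a₀ ≤ aU → 0 < a₁ → ∃ M₀ : ℕ, ∀ Mc : ℕ, McGuard F Mc → M₀ ≤ Mc →
      (∀ ε₁ : ℝ, 0 < ε₁ → ε₁ ≤ a₁ → B₃ * ε₁ ≤ a₀ → ∀ (k n : ℕ) (V : Literature.MathematicalPhysics.QuantumFieldTheory.Balaban1983to89.GaugeField (F.P (Summit.QuantumFields.YangMills.Theorems.K0RecordFormatNames.recordK₀ F Mc k + n)) (k + 1) (Literature.MathematicalPhysics.QuantumFieldTheory.Balaban1983to89.Node00.SU 2)), Literature.MathematicalPhysics.QuantumFieldTheory.Balaban1983to89.PlaqSmall ε₁ V → Literature.MathematicalPhysics.QuantumFieldTheory.Balaban1983to89.Node00.UkExists F 2 (Summit.QuantumFields.YangMills.Theorems.K0RecordFormatNames.recordK₀ F Mc k + n) (k + 1) a₀ V ∧ Literature.MathematicalPhysics.QuantumFieldTheory.Balaban1983to89.Node00.UniqueUkOrbit F 2 (Summit.QuantumFields.YangMills.Theorems.K0RecordFormatNames.recordK₀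 F Mc k + n) (k + 1) a₀ V))
    (hBg : ∀ F : T4Family, ∃ aB : ℝ, 0 < aB ∧ ∀ a₀ : ℝ, 0 < a₀ → a₀ ≤ aB → ∃ M₀ : ℕ, ∀ Mc : ℕ, McGuard F Mc → M₀ ≤ Mc →
      (∀ (k n : ℕ) (ε₂₉ : ℝ), 0 < ε₂₉ → letI θ := Summit.QuantumFields.YangMills.Theorems.K0RecordFormatNames.thetaFill F a₀ ε₂₉; letI := θ.instVβ₁; letI := θ.instVβ₂; letI := θ.instιβ; AnalyticAt ℝ (fun B : Summit.QuantumFields.YangMills.Theorems.K0RecordFormatNames.recordW F a₀ ε₂₉ k (Summit.QuantumFields.YangMills.Theorems.K0RecordFormatNames.recordK₀ F Mc k + n) => fun (b : Literature.MathematicalPhysics.QuantumFieldTheory.Balaban1983to89.PBond (F.P (Summit.QuantumFields.YangMills.Theorems.K0RecordFormatNames.recordK₀ F Mc k + n)) 0) (i i' : Fin 2) => ((Summit.QuantumFields.YangMills.Theorems.K0RecordFormatNames.recordBgField F θ k (Summit.QuantumFields.YangMills.Theorems.K0RecordFormatNames.recordK₀ F Mc k + n) B b : Literature.MathematicalPhysics.QuantumFieldTheory.Balaban1983to89.Node00.SU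 2) : Matrix (Fin 2) (Fin 2) ℂ) i i') 0)) :
    Summit.QuantumFields.YangMills.Theses.BalabanUVNodes.Record13SepCoPHInhabitedAx :=
  record13SepCoPHInhabitedAx_of_lim_residual (fun _ _ _ => True) hL hUk hBg
    (fun _ => ⟨1, one_pos, fun _ _ _ => ⟨0, fun _ _ _ => trivial⟩⟩)

/-- ★★ **EVERY CUT FACTORS THROUGH THE TOKEN-FREE LIMIT-JOIN ON THE CONSUMER SIDE**: for ANY token, `(∀ F, JoinConclLimR ⊤ F)` ∧ (R-Uk) ∧ (R-Bg) ∧ (R-Tok) ⟹ K0ᴬ — with (R-Tok) NOT USED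
(the binder is kept to display the comparison with `record13SepCoPHInhabitedAx_of_lim_residual Tok`: a stronger token buys a WEAKER `hL`, never a weaker residual elsewhere).
[cite: Balaban1987RG1, Thm 1 p.259, (1.21)–(1.22) p.264; Balaban1985Variational, Prop. 9 p.309] -/
theorem record13SepCoPHInhabitedAx_of_tokFree_anyTok (Tok : T4Family → ℕ → ℝ → Prop) (hL : ∀ F : T4Family, JoinConclLimR (fun _ _ _ => True) F)
    (hUk : ∀ F : T4Family, ∃ aU : ℝ, 0 < aU ∧ ∀ (B₃ a₀ a₁ : ℝ), 2 * (F.L : ℝ) ^ 2 ≤ B₃ → 0 < a₀ → a₀ ≤ aU → 0 < a₁ → ∃ M₀ : ℕ, ∀ Mc : ℕ, McGuard F Mc → M₀ ≤ Mc →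
      (∀ ε₁ : ℝ, 0 < ε₁ → ε₁ ≤ a₁ → B₃ * ε₁ ≤ a₀ → ∀ (k n : ℕ) (V : Literature.MathematicalPhysics.QuantumFieldTheory.Balaban1983to89.GaugeField (F.P (Summit.QuantumFields.YangMills.Theorems.K0RecordFormatNames.recordK₀ F Mc k + n)) (k + 1) (Literature.MathematicalPhysics.QuantumFieldTheory.Balaban1983to89.Node00.SU 2)), Literature.MathematicalPhysics.QuantumFieldTheory.Balaban1983to89.PlaqSmall ε₁ V → Literature.MathematicalPhysics.QuantumFieldTheory.Balaban1983to89.Node00.UkExists F 2 (Summit.QuantumFields.YangMills.Theorems.K0RecordFormatNames.recordK₀ F Mc k + n) (k + 1) a₀ V ∧ Literature.MathematicalPhysics.QuantumFieldTheory.Balaban1983to89.Node00.UniqueUkOrbit F 2 (Summit.QuantumFields.YangMills.Theorems.K0RecordFormatNames.recordK₀ F Mc k + n) (k + 1) a₀ V))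
    (hBg : ∀ F : T4Family, ∃ aB : ℝ, 0 < aB ∧ ∀ a₀ : ℝ, 0 < a₀ → a₀ ≤ aB → ∃ M₀ : ℕ, ∀ Mc : ℕ, McGuard F Mc → M₀ ≤ Mc →
      (∀ (k n : ℕ) (ε₂₉ : ℝ), 0 < ε₂₉ → letI θ := Summit.QuantumFields.YangMills.Theorems.K0RecordFormatNames.thetaFill F a₀ ε₂₉; letI := θ.instVβ₁; letI := θ.instVβ₂; letI := θ.instιβ; AnalyticAt ℝ (fun B : Summit.QuantumFields.YangMills.Theorems.K0RecordFormatNames.recordW F a₀ ε₂₉ k (Summit.QuantumFields.YangMills.Theorems.K0RecordFormatNames.recordK₀ F Mc k + n) => fun (b : Literature.MathematicalPhysics.QuantumFieldTheory.Balaban1983to89.PBond (F.P (Summit.QuantumFields.YangMills.Theorems.K0RecordFormatNames.recordK₀ F Mc k + n)) 0) (i i' : Fin 2) => ((Summit.QuantumFields.YangMills.Theorems.K0RecordFormatNames.recordBgField F θ k (Summit.QuantumFields.YangMills.Theorems.K0RecordFormatNames.recordK₀ F Mc k + n) B b : Literature.MathematicalPhysics.QuantumFieldTheory.Balaban1983to89.Node00.SU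 2) : Matrix (Fin 2) (Fin 2) ℂ) i i') 0))
    (hTok : ∀ F : T4Family, ∃ aT : ℝ, 0 < aT ∧ ∀ a₀ : ℝ, 0 < a₀ → a₀ ≤ aT → ∃ M₀ : ℕ, ∀ Mc : ℕ, McGuard F Mc → M₀ ≤ Mc → Tok F Mc a₀) :
    Summit.QuantumFields.YangMills.Theses.BalabanUVNodes.Record13SepCoPHInhabitedAx :=
  record13SepCoPHInhabitedAx_of_lim_residual Tok (fun F => joinConclLimR_of_tokFree (hL F)) hUk hBg hTok

end Summit.QuantumFields.YangMills.Theorems.K0AxJoinResidual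

end
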